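import Literature.Analysis.FluidPDE.KatoLocalBoundedPicard
import Literature.Analysis.FluidPDE.OseenKernelSemigroup
import Literature.Analysis.UnboundedOperators.HeatKernelTimeModulus
import Literature.Analysis.UnboundedOperators.HeatKernelStrongContinuityProofs
import HarnessLib

/-!
# Oseen's scheme for bounded data: restart and `C_t Lᵖ` continuity of the fixed point
(Lemarié-Rieusset, *The Navier–Stokes Problem in the 21st Century*, CRC Press 2016, proofs of
Thm. 7.5 and Thm. 9.12; Koch–Nadirashvili–Seregin–Šverák 2009, §4 (4.4))

Analysis/FluidPDE proof file (no definitions, no named facts), second layer of the discharge of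
`Literature.Analysis.FluidPDE.kato_local_bounded` (`KatoContinuation.lean`) after
`KatoLocalBoundedPicard.lean` (the fixed point `u(t) = e^{νtΔ}a - B^ν_0(u,u)(t)` of Oseen's
scheme for a bounded datum `a`, bounded by `2A` and by `2‖a‖_p` in `Lᵖ`). It supplies the time
continuity with values in `Lᵖ` required by Kato's class `C([0,T); L³)`:

* `§ Restart`: the **restart identity of the Duhamel term** of bounded measurable fields,
  `B^ν_s(u,v)(t) = e^{ν(t-θ)Δ}(B^ν_s(u,v)(θ)) + B^ν_θ(u,v)(t)` for `s < θ < t`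
  (`oseenDuhamel_eq_heatExtension_add_of_slab`; Fubini over `E × ((s,θ) × E)` and the semigroup law of
  the Oseen–Koch–Tataru kernel, `integral_heatKernel_sub_smul_oseenKernel_sub`,
  `OseenKernelSemigroup.lean`) — KNSS 2009, (4.4): the integral equation "can be treated as an ODE
  in `t`"; the sibling `NSBoundedMildOseenRestart.lean` (landed while this file was written)
  proves the same identity for a *globally* measurable and bounded field `w = u = v`
  (`heatExtension_oseenDuhamel_eq_setIntegral`, `oseenMild_restart_holds`); the versions here
  (`…_of_slab`) only assume measurability and bounds on the slab `(s, T) × E` and allow `u ≠ v`,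
  which is what the fixed point of Oseen's scheme (junk outside the slab) requires;
* `oseen_fixedPoint_restart`: hence a bounded pointwise solution restarts from every positive
  time, `u(t) = e^{ν(t-θ)Δ}u(θ) - B^ν_θ(u,u)(t)` (Lemarié-Rieusset 2016, proof of Thm. 9.12,
  (9.38));
* `continuousInLpOn_oseen_fixedPoint`: **`u ∈ C([0,T); Lᵖ)`** (with `u(0) := a`): at `t₀ = 0` by
  the strong continuity of the heat semigroup and `‖B^ν_0(u,u)(t)‖_p ≲ √t`; at `t₀ > 0` by
  `u(t) - u(θ) = (e^{ν(t-θ)Δ} - 1)u(θ) - B^ν_θ(u,u)(t)`, where the heat-flow term is small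
  **uniformly in `θ`** — restarting once more, `u(θ) = e^{νεΔ}u(θ-ε) - B^ν_{θ-ε}(u,u)(θ)`, the
  time regularity of the heat semigroup at parabolic scale
  (`UnboundedOperators.exists_eLpNorm_heatExtension_sub_le`, `HeatKernelTimeModulus.lean`) bounds
  `‖(e^{ν(t-θ)Δ} - 1)e^{νεΔ}u(θ-ε)‖_p ≤ η ‖u(θ-ε)‖_p` for `t - θ ≤ δ(η)ε`, and
  `‖B^ν_{θ-ε}(u,u)(θ)‖_p ≲ √ε`. No time derivative of the Oseen kernel is needed.

The assembly `kato_local_bounded_holds` (bounded representative of the datum, the duality form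
through `NSBoundedMildOseenDuhamel.lean`, the lifespan `c₀ν/A²`) is the next file.

## Mathlib / tree search

Tree: `KatoLocalBoundedPicard.lean` (`exists_norm_oseenDuhamel_le_mul`,
`integrable_oseenKernel_duhamel_bounded'`, `exists_eLpNorm_oseenDuhamel_le_left`,
`exists_lintegral_enorm_oseenKernel_bounded_le_mul`), `NSBoundedMildOseen(Duhamel).lean`
(`oseenDuhamel`, `oseenDuhamel_eq_integral_prod`, `aestronglyMeasurable_oseenDuhamel`),
`OseenKernelSemigroup.lean` (`integral_heatKernel_sub_smul_oseenKernel_sub`), `MildL3Restart.lean`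
(`heatExtension_sub_eq_of_memLp`), the heat toolkit (`heatExtension_add_holds`,
`memLp_heatExtension_holds`, `eLpNorm_heatExtension_le_holds`, `heatExtension_eq_integral_sub`,
`tendsto_heatExtension_nhdsWithin_zero_holds`), `HeatKernelTimeModulus.lean`. The restart for the
`oseenHeat` realisation is `integral_sum_oseenHeat_duhamel_eq_heatExtension_add`
(`OseenDuhamelMeasurable.lean`); for `oseenKernel` it was the named fact `oseenMild_restart`.
Mathlib: `integral_integral_swap`, `lintegral_prod`, `setIntegral_union`, `setIntegral_congr_set`,
`ENNReal.tendsto_nhds_zero`, `Metric.eventually_nhds_iff`, `eventually_nhdsWithin_iff`.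

## References

* P. G. Lemarié-Rieusset, *The Navier–Stokes Problem in the 21st Century*, CRC Press 2016,
  doi:10.1201/b19556 (held; PDF pages): Thm. 7.5 and its proof (pp. 155–158), proof of Thm. 9.12
  with (9.38) (p. 260). [LemarieRieusset2016]
* G. Koch, N. Nadirashvili, G. Seregin, V. Šverák, Acta Math. 203 (2009) = arXiv:0709.3599,
  §4 (4.3)–(4.4). [KochNadirashviliSereginSverak2009]
-/

noncomputable section

open MeasureTheory Set Function Filter TopologicalSpace InnerProductSpace Metric
open _root_.Topology
open scoped RealInnerProductSpace NNReal ENNReal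

namespace Literature.Analysis.FluidPDE

variable {E : Type*} [NormedAddCommGroup E] [InnerProductSpace ℝ E] [FiniteDimensional ℝ E]
  [MeasurableSpace E] [BorelSpace E]

/-! ### A null slice -/

/-- Integrals over the slabs `(s, θ] × E` and `(s, θ) × E` agree (the slice `{θ} × E` is null).
[folklore] -/
theorem setIntegral_Ioc_prod_univ_eq {G : Type*} [NormedAddCommGroup G] [NormedSpace ℝ G]
    {s θ : ℝ} (hsθ : s < θ) {f : ℝ × E → G} :
    ∫ p in Ioc s θ ×ˢ (univ : Set E), f p ∂(volume : Measure (ℝ × E)) =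
      ∫ p in Ioo s θ ×ˢ (univ : Set E), f p ∂(volume : Measure (ℝ × E)) := by
  refine setIntegral_congr_set ?_
  have hdiff : Ioc s θ \ Ioo s θ = {θ} := by
    ext r
    simp only [Set.mem_sdiff, mem_Ioc, mem_Ioo, mem_singleton_iff, not_and, not_lt]
    constructor
    · rintro ⟨⟨h1, h2⟩, h3⟩
      exact le_antisymm h2 (h3 h1)
    · rintro rfl
      exact ⟨⟨hsθ, le_rfl⟩, fun _ => le_rfl⟩
  rw [ae_eq_set]
  constructor
  · rw [Set.prod_sdiff_prod, Set.sdiff_self, prod_empty, empty_union, hdiff,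
      Measure.volume_eq_prod, Measure.prod_prod, Real.volume_singleton, zero_mul]
  · rw [Set.prod_sdiff_prod, Set.sdiff_self, prod_empty, empty_union,
      Set.sdiff_eq_empty.2 Ioo_subset_Ioc_self, empty_prod, measure_empty]

/-! ### The restart identity of the Duhamel term of bounded fields -/

section Restart

variable {ν s T : ℝ} {u v : ℝ → E → E} {Mu Mv : ℝ}

/-- **The heat flow of the Duhamel term**: for bounded measurable `u`, `v` on `(s, T) × E`,
`ν > 0` and `s < θ < t ≤ T`,
`e^{ν(t-θ)Δ}(B^ν_s(u,v)(θ))(x) = ∫_{(s,θ)×E} K(ν(t-τ), x-y)[u(τ,y), v(τ,y)] d(τ,y)`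
(Fubini over `E × ((s,θ) × E)` under the majorant `G_{ν(t-θ)}(x-y') · C Mᵤ Mᵥ ν^{-1/2} 2√(θ-s)`,
and the semigroup law of the kernel `∫ G_{t'}(x-y') K(σ, y'-y) dy' = K(σ+t', x-y)`,
`integral_heatKernel_sub_smul_oseenKernel_sub`; Koch–Nadirashvili–Seregin–Šverák 2009, §4,
(4.4): the integral equation "can be treated as an ODE in `t`"; Lemarié-Rieusset 2016, Prop. 6.4
(6.10): the Oseen tensor is `e^{τΔ}ℙ`, a semigroup in `τ`). [cite:
    KochNadirashviliSereginSverak2009, §4 (4.4) (arXiv:0709.3599)] -/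
theorem heatExtension_oseenDuhamel_eq_setIntegral_of_slab (hν : 0 < ν)
    (hu : AEStronglyMeasurable (uncurry u) ((volume : Measure (ℝ × E)).restrict (Ioo s T ×ˢ univ)))
    (hv : AEStronglyMeasurable (uncurry v) ((volume : Measure (ℝ × E)).restrict (Ioo s T ×ˢ univ)))
    (hMu : 0 ≤ Mu) (hMv : 0 ≤ Mv) (huM : ∀ τ ∈ Ioo s T, ∀ y, ‖u τ y‖ ≤ Mu)
    (hvM : ∀ τ ∈ Ioo s T, ∀ y, ‖v τ y‖ ≤ Mv) {θ t : ℝ} (hsθ : s < θ) (hθt : θ < t) (htT : t ≤ T)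
    (x : E) :
    UnboundedOperators.heatExtension (oseenDuhamel ν s u v θ) (ν * (t - θ)) x =
      ∫ p in Ioo s θ ×ˢ univ, oseenKernel (ν * (t - p.1)) (x - p.2) (u p.1 p.2) (v p.1 p.2)
        ∂(volume : Measure (ℝ × E)) := by
  have hθT : θ ≤ T := hθt.le.trans htT
  have hh : 0 < ν * (t - θ) := mul_pos hν (sub_pos.2 hθt)
  set μ : Measure (ℝ × E) := (volume : Measure (ℝ × E)).restrict (Ioo s θ ×ˢ univ) with hμ
  haveI : SFinite μ := by rw [hμ]; infer_instance
  have hM : 0 ≤ max (max Mu Mv) 0 := le_max_right _ _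
  have huM' : ∀ τ ∈ Ioo s T, ∀ y, ‖u τ y‖ ≤ max (max Mu Mv) 0 := fun τ hτ y =>
    (huM τ hτ y).trans ((le_max_left _ _).trans (le_max_left _ _))
  have hvM' : ∀ τ ∈ Ioo s T, ∀ y, ‖v τ y‖ ≤ max (max Mu Mv) 0 := fun τ hτ y =>
    (hvM τ hτ y).trans ((le_max_right _ _).trans (le_max_left _ _))
  -- the product form of `B^ν_s(u,v)(θ)` at every point
  have hB : ∀ y' : E, oseenDuhamel ν s u v θ y' =
      ∫ p, oseenKernel (ν * (θ - p.1)) (y' - p.2) (u p.1 p.2) (v p.1 p.2) ∂μ := fun y' =>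
    oseenDuhamel_eq_integral_prod hν hu hv hM huM' hvM' hsθ hθT y'
  -- the Fubini integrand `(y', p) ↦ G(x - y') • K(ν(θ - p.1), y' - p.2)[u p, v p]`
  set F : E → ℝ × E → E := fun y' p =>
    UnboundedOperators.heatKernel (ν * (t - θ)) (x - y') •
      oseenKernel (ν * (θ - p.1)) (y' - p.2) (u p.1 p.2) (v p.1 p.2) with hF
  have hsub : Ioo s θ ×ˢ (univ : Set E) ⊆ Ioo s T ×ˢ univ := prod_mono (Ioo_subset_Ioo_right hθT)
      subset_rfl
  have hu' : AEStronglyMeasurable (fun p : ℝ × E => u p.1 p.2) μ :=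
    hu.mono_measure (Measure.restrict_mono hsub le_rfl)
  have hv' : AEStronglyMeasurable (fun p : ℝ × E => v p.1 p.2) μ :=
    hv.mono_measure (Measure.restrict_mono hsub le_rfl)
  have hFm : AEStronglyMeasurable (uncurry F) ((volume : Measure E).prod μ) := by
    have hK : AEMeasurable (fun q : E × (ℝ × E) =>
        oseenKernel (ν * (θ - q.2.1)) (q.1 - q.2.2) (u q.2.1 q.2.2) (v q.2.1 q.2.2))
        ((volume : Measure E).prod μ) := by
      refine AEMeasurable.oseenKernel_comp ?_ ?_ ?_ ?_
      · exact ((measurable_const.sub measurable_snd.fst).const_mul ν).aemeasurable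
      · exact (measurable_fst.sub measurable_snd.snd).aemeasurable
      · exact (hu'.comp_snd (μ := (volume : Measure E))).aemeasurable
      · exact (hv'.comp_snd (μ := (volume : Measure E))).aemeasurable
    have hG : AEMeasurable (fun q : E × (ℝ × E) => UnboundedOperators.heatKernel (ν * (t - θ)) (x
        - q.1))
        ((volume : Measure E).prod μ) :=
      ((UnboundedOperators.continuous_heatKernel _).measurable.comp
        (measurable_const.sub measurable_fst)).aemeasurable
    exact (hG.smul hK).aestronglyMeasurable
  -- integrability by the uniform majorant in `y'`
  obtain ⟨C, hC, hmaj⟩ := exists_lintegral_enorm_oseenKernel_bounded_le_mul (E := E)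
  have hFi : Integrable (uncurry F) ((volume : Measure E).prod μ) := by
    refine ⟨hFm, ?_⟩
    rw [hasFiniteIntegral_iff_enorm, lintegral_prod _ hFm.enorm]
    set Bd : ℝ≥0∞ := ENNReal.ofReal (C * Mu * Mv * ν ^ (-(1 / 2 : ℝ)) * (2 * Real.sqrt (θ - s)))
      with hBd
    calc ∫⁻ y', ∫⁻ p, ‖uncurry F (y', p)‖ₑ ∂μ
        ≤ ∫⁻ y', ‖UnboundedOperators.heatKernel (ν * (t - θ)) (x - y')‖ₑ * Bd := by
          refine lintegral_mono fun y' => ?_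
          have h1 : ∫⁻ p, ‖uncurry F (y', p)‖ₑ ∂μ =
              ‖UnboundedOperators.heatKernel (ν * (t - θ)) (x - y')‖ₑ *
                ∫⁻ p, ‖oseenKernel (ν * (θ - p.1)) (y' - p.2) (u p.1 p.2) (v p.1 p.2)‖ₑ ∂μ := by
            rw [← lintegral_const_mul' _ _ enorm_ne_top]
            refine lintegral_congr fun p => ?_
            simp only [uncurry_apply_pair, hF, enorm_smul]
          rw [h1]
          gcongr
          rw [hμ, volume_restrict_prod_univ_eq_prod]
          exact (lintegral_prod_le _).trans (hmaj hν hsθ hMu hMv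
            (fun τ hτ y => huM τ ⟨hτ.1, hτ.2.trans_le hθT⟩ y)
            (fun τ hτ y => hvM τ ⟨hτ.1, hτ.2.trans_le hθT⟩ y) y')
      _ = (∫⁻ y', ‖UnboundedOperators.heatKernel (ν * (t - θ)) (x - y')‖ₑ) * Bd :=
          lintegral_mul_const _ ((UnboundedOperators.continuous_heatKernel _).measurable.comp
            (measurable_const.sub measurable_id)).enorm
      _ < ∞ := by
          refine ENNReal.mul_lt_top ?_ ENNReal.ofReal_lt_top
          have h := (UnboundedOperators.integrable_heatKernel_holds (E := E) hh).2
          rw [hasFiniteIntegral_iff_enorm] at h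
          rwa [lintegral_sub_left_eq_self (fun z => ‖UnboundedOperators.heatKernel (ν * (t - θ))
              z‖ₑ) x]
            at ⊢
  -- Fubini and the semigroup law of the kernel
  calc UnboundedOperators.heatExtension (oseenDuhamel ν s u v θ) (ν * (t - θ)) x
      = ∫ y', UnboundedOperators.heatKernel (ν * (t - θ)) (x - y') • oseenDuhamel ν s u v θ y' :=
        UnboundedOperators.heatExtension_eq_integral_sub _ _ _
    _ = ∫ y', (∫ p, F y' p ∂μ) := by
        congr 1
        funext y'
        rw [hB y', ← integral_smul]
    _ = ∫ p, (∫ y', F y' p) ∂μ := integral_integral_swap hFi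
    _ = ∫ p, oseenKernel (ν * (t - p.1)) (x - p.2) (u p.1 p.2) (v p.1 p.2) ∂μ := by
        rw [hμ]
        refine setIntegral_congr_fun (measurableSet_Ioo.prod MeasurableSet.univ) fun p hp => ?_
        rw [mem_prod] at hp
        have hσ : 0 < ν * (θ - p.1) := mul_pos hν (sub_pos.2 hp.1.2)
        simp only [hF]
        rw [integral_heatKernel_sub_smul_oseenKernel_sub hσ hh]
        congr 1
        ring

/-- **The restart identity of the Duhamel term of bounded fields**
(Koch–Nadirashvili–Seregin–Šverák 2009, §4 (4.4); Lemarié-Rieusset 2016, proof of Thm. 9.12,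
(9.38): the series from `W_{ν(t-t₀)} ∗ u(t₀)`): for `s < θ < t ≤ T`,
`B^ν_s(u,v)(t) = e^{ν(t-θ)Δ}(B^ν_s(u,v)(θ)) + B^ν_θ(u,v)(t)` pointwise. [cite:
    KochNadirashviliSereginSverak2009, §4 (4.4) (arXiv:0709.3599)] -/
theorem oseenDuhamel_eq_heatExtension_add_of_slab (hν : 0 < ν)
    (hu : AEStronglyMeasurable (uncurry u) ((volume : Measure (ℝ × E)).restrict (Ioo s T ×ˢ univ)))
    (hv : AEStronglyMeasurable (uncurry v) ((volume : Measure (ℝ × E)).restrict (Ioo s T ×ˢ univ)))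
    (hMu : 0 ≤ Mu) (hMv : 0 ≤ Mv) (huM : ∀ τ ∈ Ioo s T, ∀ y, ‖u τ y‖ ≤ Mu)
    (hvM : ∀ τ ∈ Ioo s T, ∀ y, ‖v τ y‖ ≤ Mv) {θ t : ℝ} (hsθ : s < θ) (hθt : θ < t) (htT : t ≤ T)
    (x : E) :
    oseenDuhamel ν s u v t x =
      UnboundedOperators.heatExtension (oseenDuhamel ν s u v θ) (ν * (t - θ)) x +
        oseenDuhamel ν θ u v t x := by
  have hst : s < t := hsθ.trans hθt
  have hM : 0 ≤ max (max Mu Mv) 0 := le_max_right _ _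
  have huM' : ∀ τ ∈ Ioo s T, ∀ y, ‖u τ y‖ ≤ max (max Mu Mv) 0 := fun τ hτ y =>
    (huM τ hτ y).trans ((le_max_left _ _).trans (le_max_left _ _))
  have hvM' : ∀ τ ∈ Ioo s T, ∀ y, ‖v τ y‖ ≤ max (max Mu Mv) 0 := fun τ hτ y =>
    (hvM τ hτ y).trans ((le_max_right _ _).trans (le_max_left _ _))
  -- measurability and bounds on the sub-slab `(θ, T)`
  have hsubθ : Ioo θ T ×ˢ (univ : Set E) ⊆ Ioo s T ×ˢ univ := prod_mono (Ioo_subset_Ioo_left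
      hsθ.le) subset_rfl
  have huθ := hu.mono_measure (Measure.restrict_mono hsubθ le_rfl)
  have hvθ := hv.mono_measure (Measure.restrict_mono hsubθ le_rfl)
  set K : ℝ × E → E := fun p => oseenKernel (ν * (t - p.1)) (x - p.2) (u p.1 p.2) (v p.1 p.2) with
      hK
  -- integrability on `(s, t) × E`
  have hint : Integrable K ((volume : Measure (ℝ × E)).restrict (Ioo s t ×ˢ univ)) :=
    integrable_oseenKernel_duhamel_bounded' hν hu hv huM hvM hst htT x
  -- `(s,t) × E = (s,θ] × E ∪ (θ,t) × E`
  have hsplit : Ioo s t ×ˢ (univ : Set E) = Ioc s θ ×ˢ univ ∪ Ioo θ t ×ˢ univ := by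
    rw [← union_prod, Ioc_union_Ioo_eq_Ioo hsθ.le hθt]
  have hdisj : Disjoint (Ioc s θ ×ˢ (univ : Set E)) (Ioo θ t ×ˢ univ) := by
    rw [Set.disjoint_prod]
    exact Or.inl (disjoint_left.2 fun r hr hr' => (not_lt.2 hr.2) hr'.1)
  have hint' : IntegrableOn K (Ioo s t ×ˢ (univ : Set E)) (volume : Measure (ℝ × E)) := hint
  have h1 : IntegrableOn K (Ioc s θ ×ˢ (univ : Set E)) (volume : Measure (ℝ × E)) :=
    hint'.mono_set (by rw [hsplit]; exact subset_union_left)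
  have h2 : IntegrableOn K (Ioo θ t ×ˢ (univ : Set E)) (volume : Measure (ℝ × E)) :=
    hint'.mono_set (by rw [hsplit]; exact subset_union_right)
  have e1 : ∫ p in Ioo s t ×ˢ (univ : Set E), K p ∂(volume : Measure (ℝ × E)) =
      (∫ p in Ioo s θ ×ˢ (univ : Set E), K p ∂(volume : Measure (ℝ × E))) +
        ∫ p in Ioo θ t ×ˢ (univ : Set E), K p ∂(volume : Measure (ℝ × E)) := by
    rw [hsplit, setIntegral_union hdisj (measurableSet_Ioo.prod MeasurableSet.univ) h1 h2,
      setIntegral_Ioc_prod_univ_eq hsθ]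
  rw [heatExtension_oseenDuhamel_eq_setIntegral_of_slab hν hu hv hMu hMv huM hvM hsθ hθt htT x,
    oseenDuhamel_eq_integral_prod hν hu hv hM huM' hvM' hst htT x,
    oseenDuhamel_eq_integral_prod hν huθ hvθ hM
      (fun τ hτ y => huM' τ ⟨hsθ.trans hτ.1, hτ.2⟩ y) (fun τ hτ y => hvM' τ ⟨hsθ.trans hτ.1, hτ.2⟩
          y)
      hθt htT x]
  exact e1

end Restart

/-! ### The fixed point: restart identity and `C_t Lᵖ` continuity -/

section FixedPoint

variable {ν T A M : ℝ} {a : E → E} {u : ℝ → E → E}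

/-- **Restart of a bounded solution of the Oseen integral equation** (Lemarié-Rieusset 2016,
proof of Thm. 9.12, (9.38): `V₀ = W_{ν(t-t₀)} ∗ u(t₀)`; Koch–Nadirashvili–Seregin–Šverák 2009, §4
(4.4)): if `u` is bounded and measurable on `(0, T) × E` and solves
`u(t) = e^{νtΔ}a - B^ν_0(u,u)(t)` pointwise there (`a` bounded measurable), then for
`0 < θ < t < T`, pointwise, `u(t) = e^{ν(t-θ)Δ}u(θ) - B^ν_θ(u,u)(t)`.
[cite: LemarieRieusset2016, Thm. 9.12 (proof, (9.38), PDF p. 260)] -/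
theorem oseen_fixedPoint_restart (hν : 0 < ν) (ham : AEStronglyMeasurable a volume)
    (habd : ∀ x, ‖a x‖ ≤ A)
    (hu : AEStronglyMeasurable (uncurry u) ((volume : Measure (ℝ × E)).restrict (Ioo 0 T ×ˢ univ)))
    (hM : 0 ≤ M) (hubd : ∀ t ∈ Ioo 0 T, ∀ x, ‖u t x‖ ≤ M)
    (hfix : ∀ t ∈ Ioo 0 T, ∀ x,
      u t x = UnboundedOperators.heatExtension a (ν * t) x - oseenDuhamel ν 0 u u t x)
    {θ t : ℝ} (hθ : 0 < θ) (hθt : θ < t) (htT : t < T) (x : E) :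
    u t x = UnboundedOperators.heatExtension (u θ) (ν * (t - θ)) x - oseenDuhamel ν θ u u t x := by
  have hθT : θ ∈ Ioo 0 T := ⟨hθ, hθt.trans htT⟩
  have hνθ : 0 < ν * θ := mul_pos hν hθ
  have hνh : 0 < ν * (t - θ) := mul_pos hν (sub_pos.2 hθt)
  have ha_top : MemLp a ∞ (volume : Measure E) := memLp_top_of_bound ham A (Eventually.of_forall
      habd)
  -- the two pieces of the slice `u θ`, both in `L^∞`
  have hU : MemLp (fun x => UnboundedOperators.heatExtension a (ν * θ) x) ∞ (volume : Measure E) :=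
    UnboundedOperators.memLp_heatExtension_holds ha_top le_top hνθ
  obtain ⟨C, hC, hBsup⟩ := exists_norm_oseenDuhamel_le_mul (E := E)
  have hB : MemLp (oseenDuhamel ν 0 u u θ) ∞ (volume : Measure E) :=
    memLp_top_of_bound (aestronglyMeasurable_oseenDuhamel hν hu hu hM hubd hubd hθ hθT.2.le) _
      (Eventually.of_forall fun y => hBsup hν hθ hM hM (fun τ hτ z => hubd τ ⟨hτ.1, hτ.2.trans
          hθT.2⟩ z)
        (fun τ hτ z => hubd τ ⟨hτ.1, hτ.2.trans hθT.2⟩ z) y)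
  have hslice : u θ = (fun x => UnboundedOperators.heatExtension a (ν * θ) x) - oseenDuhamel ν 0 u
      u θ :=
    funext fun y => hfix θ hθT y
  -- heat flow of the slice
  have h1 : UnboundedOperators.heatExtension (u θ) (ν * (t - θ)) x =
      UnboundedOperators.heatExtension a (ν * t) x -
        UnboundedOperators.heatExtension (oseenDuhamel ν 0 u u θ) (ν * (t - θ)) x := by
    rw [hslice, heatExtension_sub_eq_of_memLp hU hB le_top hνh, Pi.sub_apply]
    congr 1
    have hsg := UnboundedOperators.heatExtension_add_holds ha_top le_top hνθ hνh
    have : (fun x => UnboundedOperators.heatExtension a (ν * θ) x) =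
        UnboundedOperators.heatExtension a (ν * θ) := rfl
    rw [this, hsg]
    congr 1
    ring
  have h2 := oseenDuhamel_eq_heatExtension_add_of_slab hν hu hu hM hM hubd hubd hθ hθt htT.le x
  rw [h1, hfix t ⟨hθ.trans hθt, htT⟩ x, h2]
  abel

/-- **Short-time `Lᵖ` bound of the Duhamel term of a bounded `L^∞_t Lᵖ` field from any initial
time** (the `Lᵖ` bound of `KatoLocalBoundedPicard.lean` on the sub-slab `(θ, T)`): with the
constant `C` of `exists_eLpNorm_oseenDuhamel_le_left`, for `0 ≤ θ < t ≤ T`,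
`‖B^ν_θ(u,u)(t)‖_{Lᵖ} ≤ C M ν^{-1/2} 2√(t-θ) · L`. [folklore] -/
theorem eLpNorm_oseenDuhamel_fixedPoint_le {p : ℝ≥0∞} (hp1 : 1 ≤ p) (hp : p ≠ ∞) {C : ℝ}
    (hC : ∀ {ν : ℝ}, 0 < ν → ∀ {s T : ℝ} {u v : ℝ → E → E} {Mu Mv : ℝ},
      AEStronglyMeasurable (uncurry u) ((volume : Measure (ℝ × E)).restrict (Ioo s T ×ˢ univ)) →
      AEStronglyMeasurable (uncurry v) ((volume : Measure (ℝ × E)).restrict (Ioo s T ×ˢ univ)) →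
      0 ≤ Mu → (∀ τ ∈ Ioo s T, ∀ y, ‖u τ y‖ ≤ Mu) → (∀ τ ∈ Ioo s T, ∀ y, ‖v τ y‖ ≤ Mv) →
      ∀ {p : ℝ≥0∞}, 1 ≤ p → p ≠ ∞ → ∀ {L : ℝ≥0∞}, (∀ τ ∈ Ioo s T, eLpNorm (v τ) p volume ≤ L) →
      ∀ {t : ℝ}, s < t → t ≤ T →
        eLpNorm (oseenDuhamel ν s u v t) p volume ≤
          ENNReal.ofReal (C * Mu * ν ^ (-(1 / 2 : ℝ)) * (2 * Real.sqrt (t - s))) * L)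
    (hν : 0 < ν)
    (hu : AEStronglyMeasurable (uncurry u) ((volume : Measure (ℝ × E)).restrict (Ioo 0 T ×ˢ univ)))
    (hM : 0 ≤ M) (hubd : ∀ t ∈ Ioo 0 T, ∀ x, ‖u t x‖ ≤ M) {L : ℝ≥0∞}
    (huLp : ∀ t ∈ Ioo 0 T, eLpNorm (u t) p volume ≤ L) {θ t : ℝ} (hθ : 0 ≤ θ) (hθt : θ < t)
    (htT : t ≤ T) :
    eLpNorm (oseenDuhamel ν θ u u t) p volume ≤
      ENNReal.ofReal (C * M * ν ^ (-(1 / 2 : ℝ)) * (2 * Real.sqrt (t - θ))) * L := by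
  have hsub : Ioo θ T ×ˢ (univ : Set E) ⊆ Ioo 0 T ×ˢ univ := prod_mono (Ioo_subset_Ioo_left hθ)
      subset_rfl
  have huθ := hu.mono_measure (Measure.restrict_mono hsub le_rfl)
  exact hC hν huθ huθ hM (fun τ hτ y => hubd τ ⟨hθ.trans_lt hτ.1, hτ.2⟩ y)
    (fun τ hτ y => hubd τ ⟨hθ.trans_lt hτ.1, hτ.2⟩ y) hp1 hp
    (fun τ hτ => huLp τ ⟨hθ.trans_lt hτ.1, hτ.2⟩) hθt htT

/-- **The `C([0,T); Lᵖ)` continuity of a bounded solution of Oseen's scheme**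
(Lemarié-Rieusset 2016, Thm. 7.5 and its proof, PDF pp. 155–158: the fixed point "belongs to
`C([0,T₀], L³)`"; here for the `L^∞` scheme with the `Lᵖ` bound carried along). Let `u` be
bounded (`|u| ≤ M`) and measurable on `(0, T) × E` with measurable slices, `‖u(t)‖_{Lᵖ} ≤ L`
(`1 ≤ p < ∞`, `L < ∞`), solving `u(t) = e^{νtΔ}a - B^ν_0(u,u)(t)` pointwise, with `a` bounded,
measurable and in `Lᵖ`. Then the field `w(t) = u(t)` (`t > 0`), `w(0) = a` is continuous on
`[0, T)` with values in `Lᵖ`. At `t₀ = 0`: `u(t) - a = (e^{νtΔ}a - a) - B^ν_0(u,u)(t)`, strong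
continuity of the heat semigroup and `‖B^ν_0(u,u)(t)‖_p ≲ √t`. At `t₀ > 0`, for `θ < t` near `t₀`:
`u(t) - u(θ) = (e^{ν(t-θ)Δ} - 1)u(θ) - B^ν_θ(u,u)(t)` (restart), and the first term is small
**uniformly in `θ`** because `u(θ) = e^{νεΔ}u(θ-ε) - B^ν_{θ-ε}(u,u)(θ)` with
`‖(e^{ν(t-θ)Δ} - 1)e^{νεΔ}u(θ-ε)‖_p ≤ η L` for `t - θ ≤ δ(η) ε` (time regularity of the heat
semigroup at parabolic scale, `exists_eLpNorm_heatExtension_sub_le`) and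
`‖B^ν_{θ-ε}(u,u)(θ)‖_p ≲ √ε`. [cite: LemarieRieusset2016, Thm. 7.5 (proof, PDF pp. 155–158)] -/
theorem continuousInLpOn_oseen_fixedPoint {p : ℝ≥0∞} (hp1 : 1 ≤ p) (hp : p ≠ ∞) (hν : 0 < ν)
    (ham : AEStronglyMeasurable a volume) (habd : ∀ x, ‖a x‖ ≤ A)
    (hap : MemLp a p volume)
    (hu : AEStronglyMeasurable (uncurry u) ((volume : Measure (ℝ × E)).restrict (Ioo 0 T ×ˢ univ)))
    (hM : 0 ≤ M) (hubd : ∀ t ∈ Ioo 0 T, ∀ x, ‖u t x‖ ≤ M) {L : ℝ≥0}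
    (huLp : ∀ t ∈ Ioo 0 T, eLpNorm (u t) p volume ≤ L)
    (husl : ∀ t ∈ Ioo 0 T, AEStronglyMeasurable (u t) volume)
    (hfix : ∀ t ∈ Ioo 0 T, ∀ x,
      u t x = UnboundedOperators.heatExtension a (ν * t) x - oseenDuhamel ν 0 u u t x) :
    ContinuousInLpOn (Ico 0 T) p (fun t x => if 0 < t then u t x else a x) := by
  set w : ℝ → E → E := fun t x => if 0 < t then u t x else a x with hw_def
  have hw_pos : ∀ {t : ℝ}, 0 < t → w t = u t := fun ht => funext fun x => if_pos ht
  have hw_zero : w 0 = a := funext fun x => if_neg (lt_irrefl 0)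
  have hmem_u : ∀ t ∈ Ioo 0 T, MemLp (u t) p volume := fun t ht =>
    ⟨husl t ht, (huLp t ht).trans_lt ENNReal.coe_lt_top⟩
  obtain ⟨C, hC, hCle⟩ := exists_eLpNorm_oseenDuhamel_le_left (E := E)
  have hνpow : 0 < ν ^ (-(1 / 2 : ℝ)) := Real.rpow_pos_of_pos hν _
  -- the Duhamel bound over short intervals, as a real number
  set Kc : ℝ := C * M * ν ^ (-(1 / 2 : ℝ)) * 2 * L with hKc
  have hKc0 : 0 ≤ Kc := by positivity
  have hDuh : ∀ {θ t : ℝ}, 0 ≤ θ → θ < t → t ≤ T →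
      eLpNorm (oseenDuhamel ν θ u u t) p volume ≤ ENNReal.ofReal (Kc * Real.sqrt (t - θ)) := by
    intro θ t hθ hθt htT
    refine (eLpNorm_oseenDuhamel_fixedPoint_le hp1 hp hCle hν hu hM hubd
      (fun τ hτ => huLp τ hτ) hθ hθt htT).trans (le_of_eq ?_)
    rw [← ENNReal.ofReal_coe_nnreal, ← ENNReal.ofReal_mul (by positivity), hKc]
    ring_nf
  -- (E1): `‖u t - u θ‖ ≤ ‖(e^{νhΔ}-1)u θ‖ + Kc √(t-θ)` for `0 < θ < t < T`
  have hE1 : ∀ {θ t : ℝ}, 0 < θ → θ < t → t < T →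
      eLpNorm (u t - u θ) p volume ≤
        eLpNorm (UnboundedOperators.heatExtension (u θ) (ν * (t - θ)) - u θ) p volume +
          ENNReal.ofReal (Kc * Real.sqrt (t - θ)) := by
    intro θ t hθ hθt htT
    have hθT : θ ∈ Ioo 0 T := ⟨hθ, hθt.trans htT⟩
    have heq : u t - u θ = (UnboundedOperators.heatExtension (u θ) (ν * (t - θ)) - u θ) -
        oseenDuhamel ν θ u u t := by
      funext x
      simp only [Pi.sub_apply]
      rw [oseen_fixedPoint_restart hν ham habd hu hM hubd hfix hθ hθt htT x]
      abel
    rw [heq]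
    have hm1 : AEStronglyMeasurable (UnboundedOperators.heatExtension (u θ) (ν * (t - θ)) - u θ)
        volume :=
      (UnboundedOperators.memLp_heatExtension_holds (hmem_u θ hθT) hp1 (mul_pos hν (sub_pos.2
          hθt))).1.sub
        (husl θ hθT)
    have hsub : Ioo θ T ×ˢ (univ : Set E) ⊆ Ioo 0 T ×ˢ univ := prod_mono (Ioo_subset_Ioo_left
        hθ.le) subset_rfl
    have huθ := hu.mono_measure (Measure.restrict_mono hsub le_rfl)
    have hm2 : AEStronglyMeasurable (oseenDuhamel ν θ u u t) volume :=
      aestronglyMeasurable_oseenDuhamel hν huθ huθ hM (fun τ hτ y => hubd τ ⟨hθ.trans hτ.1, hτ.2⟩ y)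
        (fun τ hτ y => hubd τ ⟨hθ.trans hτ.1, hτ.2⟩ y) hθt htT.le
    exact (eLpNorm_sub_le hm1 hm2 hp1).trans (add_le_add le_rfl (hDuh hθ.le hθt htT.le))
  -- (E2): the heat-flow term is small uniformly in `θ`, through the restart at `θ - ε`
  have hE2 : ∀ {η δ : ℝ}, 0 < η →
      (∀ {g : E → E} {q : ℝ≥0∞}, MemLp g q volume → 1 ≤ q → ∀ {τ h : ℝ}, 0 < τ → 0 ≤ h → h ≤ δ * τ →
        eLpNorm (UnboundedOperators.heatExtension g (τ + h) - UnboundedOperators.heatExtension g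
            τ) q volume ≤
          ENNReal.ofReal η * eLpNorm g q volume) →
      ∀ {ε θ t : ℝ}, 0 < ε → ε < θ → θ < t → t < T → t - θ ≤ δ * ε →
        eLpNorm (UnboundedOperators.heatExtension (u θ) (ν * (t - θ)) - u θ) p volume ≤
          ENNReal.ofReal (η * L) + 2 * ENNReal.ofReal (Kc * Real.sqrt ε) := by
    intro η δ hη hmod ε θ t hε hεθ hθt htT hδ
    have hθ : 0 < θ := hε.trans hεθ
    have hθT : θ ∈ Ioo 0 T := ⟨hθ, hθt.trans htT⟩
    have hθε : 0 < θ - ε := sub_pos.2 hεθ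
    have hθεT : θ - ε ∈ Ioo 0 T := ⟨hθε, by linarith [hθT.2]⟩
    have hνε : 0 < ν * ε := mul_pos hν hε
    have hνh : 0 < ν * (t - θ) := mul_pos hν (sub_pos.2 hθt)
    -- `u θ = e^{νεΔ}u(θ-ε) - B_{θ-ε}(u,u)(θ)`
    have hrest : u θ = UnboundedOperators.heatExtension (u (θ - ε)) (ν * ε) -
        oseenDuhamel ν (θ - ε) u u θ := by
      funext x
      have h := oseen_fixedPoint_restart hν ham habd hu hM hubd hfix hθε (by linarith) hθT.2 x
      rw [show θ - (θ - ε) = ε by ring] at h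
      exact h
    -- the two pieces in `L^∞` and `Lᵖ`
    have hsub : Ioo (θ - ε) T ×ˢ (univ : Set E) ⊆ Ioo 0 T ×ˢ univ :=
      prod_mono (Ioo_subset_Ioo_left hθε.le) subset_rfl
    have huθε := hu.mono_measure (Measure.restrict_mono hsub le_rfl)
    have hbθε : ∀ τ ∈ Ioo (θ - ε) T, ∀ y, ‖u τ y‖ ≤ M := fun τ hτ y => hubd τ ⟨hθε.trans hτ.1,
        hτ.2⟩ y
    obtain ⟨C', hC', hBsup⟩ := exists_norm_oseenDuhamel_le_mul (E := E)
    have hBm : AEStronglyMeasurable (oseenDuhamel ν (θ - ε) u u θ) volume :=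
      aestronglyMeasurable_oseenDuhamel hν huθε huθε hM hbθε hbθε (by linarith) hθT.2.le
    have hB_top : MemLp (oseenDuhamel ν (θ - ε) u u θ) ∞ (volume : Measure E) :=
      memLp_top_of_bound hBm _ (Eventually.of_forall fun y => hBsup hν (by linarith : θ - ε < θ)
          hM hM
        (fun τ hτ z => hubd τ ⟨hθε.trans hτ.1, hτ.2.trans hθT.2⟩ z)
        (fun τ hτ z => hubd τ ⟨hθε.trans hτ.1, hτ.2.trans hθT.2⟩ z) y)
    have hB_p : MemLp (oseenDuhamel ν (θ - ε) u u θ) p (volume : Measure E) :=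
      ⟨hBm, (hDuh hθε.le (by linarith) hθT.2.le).trans_lt ENNReal.ofReal_lt_top⟩
    have hg_top : MemLp (u (θ - ε)) ∞ (volume : Measure E) :=
      memLp_top_of_bound (husl _ hθεT) M (Eventually.of_forall fun y => hubd _ hθεT y)
    have hU_top : MemLp (UnboundedOperators.heatExtension (u (θ - ε)) (ν * ε)) ∞ (volume : Measure
        E) :=
      UnboundedOperators.memLp_heatExtension_holds hg_top le_top hνε
    -- heat flow of `u θ`
    have hflow : UnboundedOperators.heatExtension (u θ) (ν * (t - θ)) - u θ =
        (UnboundedOperators.heatExtension (u (θ - ε)) (ν * ε + ν * (t - θ)) -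
          UnboundedOperators.heatExtension (u (θ - ε)) (ν * ε)) -
        (UnboundedOperators.heatExtension (oseenDuhamel ν (θ - ε) u u θ) (ν * (t - θ)) -
          oseenDuhamel ν (θ - ε) u u θ) := by
      rw [hrest, heatExtension_sub_eq_of_memLp hU_top hB_top le_top hνh,
        UnboundedOperators.heatExtension_add_holds hg_top le_top hνε hνh]
      abel
    rw [hflow]
    have hm_a : AEStronglyMeasurable (UnboundedOperators.heatExtension (u (θ - ε)) (ν * ε + ν * (t
        - θ)) -
        UnboundedOperators.heatExtension (u (θ - ε)) (ν * ε)) volume :=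
      (UnboundedOperators.memLp_heatExtension_holds (hmem_u _ hθεT) hp1 (by positivity)).1.sub
        (UnboundedOperators.memLp_heatExtension_holds (hmem_u _ hθεT) hp1 hνε).1
    have hm_b : AEStronglyMeasurable (UnboundedOperators.heatExtension (oseenDuhamel ν (θ - ε) u u
        θ) (ν * (t - θ)) -
        oseenDuhamel ν (θ - ε) u u θ) volume :=
      (UnboundedOperators.memLp_heatExtension_holds hB_p hp1 hνh).1.sub hBm
    refine (eLpNorm_sub_le hm_a hm_b hp1).trans (add_le_add ?_ ?_)
    · -- time regularity of the heat semigroup at parabolic scale `ν(t-θ) ≤ δ · νε`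
      have h := hmod (hmem_u _ hθεT) hp1 hνε hνh.le (by nlinarith [hν.le])
      refine h.trans ?_
      rw [ENNReal.ofReal_mul hη.le, ENNReal.ofReal_coe_nnreal]
      gcongr
      exact huLp _ hθεT
    · calc eLpNorm (UnboundedOperators.heatExtension (oseenDuhamel ν (θ - ε) u u θ) (ν * (t - θ)) -
            oseenDuhamel ν (θ - ε) u u θ) p volume
          ≤ eLpNorm (UnboundedOperators.heatExtension (oseenDuhamel ν (θ - ε) u u θ) (ν * (t -
              θ))) p volume +
              eLpNorm (oseenDuhamel ν (θ - ε) u u θ) p volume :=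
            eLpNorm_sub_le (UnboundedOperators.memLp_heatExtension_holds hB_p hp1 hνh).1 hBm hp1
        _ ≤ eLpNorm (oseenDuhamel ν (θ - ε) u u θ) p volume + eLpNorm (oseenDuhamel ν (θ - ε) u u
            θ) p volume :=
            add_le_add (UnboundedOperators.eLpNorm_heatExtension_le_holds hB_p hp1 hνh) le_rfl
        _ ≤ ENNReal.ofReal (Kc * Real.sqrt ε) + ENNReal.ofReal (Kc * Real.sqrt ε) := by
            have h := hDuh hθε.le (by linarith : θ - ε < θ) hθT.2.le
            rw [show θ - (θ - ε) = ε by ring] at h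
            exact add_le_add h h
        _ = 2 * ENNReal.ofReal (Kc * Real.sqrt ε) := by rw [two_mul]
  -- the modulus `Kc √ρ ≤ c` for `ρ ≤ (c/(Kc+1))²`
  have hsqrt : ∀ {c ρ : ℝ}, 0 ≤ c → 0 ≤ ρ → ρ ≤ (c / (Kc + 1)) ^ 2 → Kc * Real.sqrt ρ ≤ c := by
    intro c ρ hc hρ hle
    have h1 : Real.sqrt ρ ≤ c / (Kc + 1) := by
      rw [← Real.sqrt_sq (by positivity : 0 ≤ c / (Kc + 1))]
      exact Real.sqrt_le_sqrt hle
    calc Kc * Real.sqrt ρ ≤ Kc * (c / (Kc + 1)) := by gcongr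
      _ ≤ (Kc + 1) * (c / (Kc + 1)) := by gcongr; linarith
      _ = c := by field_simp
  refine ⟨fun t ht => ?_, fun t₀ ht₀ => ?_⟩
  · -- slices in `Lᵖ`
    rcases ht.1.eq_or_lt with h | h
    · rw [← h, hw_zero]; exact hap
    · rw [hw_pos h]; exact hmem_u t ⟨h, ht.2⟩
  · rw [ENNReal.tendsto_nhds_zero]
    intro κ hκ
    rcases eq_or_ne κ ⊤ with hκtop | hκtop
    · exact Eventually.of_forall fun t => hκtop ▸ le_top
    have hκr : 0 < κ.toReal := ENNReal.toReal_pos hκ.ne' hκtop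
    have hκeq : ENNReal.ofReal κ.toReal = κ := ENNReal.ofReal_toReal hκtop
    rcases ht₀.1.eq_or_lt with h0 | ht₀pos
    · -- continuity at `t₀ = 0`: strong continuity of the heat semigroup and `‖B(t)‖_p ≲ √t`
      subst h0
      have hsc := UnboundedOperators.tendsto_heatExtension_nhdsWithin_zero_holds hap hp1 hp
      rw [ENNReal.tendsto_nhds_zero] at hsc
      have hev := hsc (ENNReal.ofReal (κ.toReal / 2)) (ENNReal.ofReal_pos.2 (by positivity))
      rw [eventually_nhdsWithin_iff, Metric.eventually_nhds_iff] at hev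
      obtain ⟨s₀, hs₀, hs⟩ := hev
      set ρ : ℝ := min (s₀ / (2 * ν)) ((κ.toReal / 2 / (Kc + 1)) ^ 2) with hρ
      have hρpos : 0 < ρ := lt_min (by positivity) (by positivity)
      have hball : Metric.ball (0 : ℝ) ρ ∈ 𝓝 (0 : ℝ) := Metric.ball_mem_nhds 0 hρpos
      filter_upwards [mem_nhdsWithin_of_mem_nhds hball, self_mem_nhdsWithin] with t htρ ht
      rcases ht.1.eq_or_lt with h | htpos
      · rw [← h]; simp
      rw [hw_pos htpos, hw_zero]
      have htρ' : t < ρ := by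
        rw [Metric.mem_ball, dist_zero_right, Real.norm_eq_abs, abs_of_pos htpos] at htρ
        exact htρ
      -- `u t - a = (e^{νtΔ}a - a) - B_0(u,u)(t)`
      have heq : u t - a =
          (UnboundedOperators.heatExtension a (ν * t) - a) - oseenDuhamel ν 0 u u t := by
        funext x
        simp only [Pi.sub_apply]
        rw [hfix t ⟨htpos, ht.2⟩ x]
        abel
      rw [heq]
      have hm1 : AEStronglyMeasurable (UnboundedOperators.heatExtension a (ν * t) - a) volume :=
        (UnboundedOperators.memLp_heatExtension_holds hap hp1 (mul_pos hν htpos)).1.sub ham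
      have hm2 : AEStronglyMeasurable (oseenDuhamel ν 0 u u t) volume :=
        aestronglyMeasurable_oseenDuhamel hν hu hu hM hubd hubd htpos ht.2.le
      refine (eLpNorm_sub_le hm1 hm2 hp1).trans ?_
      rw [← hκeq, show κ.toReal = κ.toReal / 2 + κ.toReal / 2 by ring,
        ENNReal.ofReal_add (by positivity) (by positivity)]
      refine add_le_add ?_ ?_
      · -- `νt < s₀`
        have hνt : ν * t ∈ Ioi (0 : ℝ) := mul_pos hν htpos
        have hdist : dist (ν * t) 0 < s₀ := by
          rw [dist_zero_right, Real.norm_eq_abs, abs_of_pos (mul_pos hν htpos)]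
          have h1 : t < s₀ / (2 * ν) := htρ'.trans_le (min_le_left _ _)
          rw [lt_div_iff₀ (by positivity)] at h1
          nlinarith
        exact hs hdist hνt
      · refine (hDuh le_rfl htpos ht.2.le).trans (ENNReal.ofReal_le_ofReal ?_)
        rw [sub_zero]
        exact hsqrt (by positivity) htpos.le (htρ'.le.trans (min_le_right _ _))
    · -- continuity at `t₀ > 0`
      set η : ℝ := κ.toReal / 4 / ((L : ℝ) + 1) with hη
      have hηpos : 0 < η := by positivity
      have hηL : η * L ≤ κ.toReal / 4 := by
        have hL0 : (0 : ℝ) ≤ L := L.coe_nonneg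
        rw [hη, div_mul_eq_mul_div, div_le_iff₀ (by positivity)]
        nlinarith
      obtain ⟨δ, hδ, hmod⟩ :=
        UnboundedOperators.exists_eLpNorm_heatExtension_sub_le (E := E) (F := E) hηpos
      set ε : ℝ := min (t₀ / 4) ((κ.toReal / 8 / (Kc + 1)) ^ 2) with hε
      have hεpos : 0 < ε := lt_min (by positivity) (by positivity)
      have hεt₀ : ε ≤ t₀ / 4 := min_le_left _ _
      have hKcε : Kc * Real.sqrt ε ≤ κ.toReal / 8 :=
        hsqrt (by positivity) hεpos.le (min_le_right _ _)
      set ρ : ℝ := min (δ * ε) (min (t₀ / 2) ((κ.toReal / 4 / (Kc + 1)) ^ 2)) with hρ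
      have hρpos : 0 < ρ := lt_min (by positivity) (lt_min (by positivity) (by positivity))
      have hρ1 : ρ ≤ δ * ε := min_le_left _ _
      have hρ2 : ρ ≤ t₀ / 2 := (min_le_right _ _).trans (min_le_left _ _)
      have hρ3 : ρ ≤ (κ.toReal / 4 / (Kc + 1)) ^ 2 := (min_le_right _ _).trans (min_le_right _ _)
      -- the symmetric estimate
      have key : ∀ {θ t' : ℝ}, t₀ / 2 ≤ θ → θ < t' → t' < T → t' - θ < ρ →
          eLpNorm (u t' - u θ) p volume ≤ κ := by
        intro θ t' hθ hθt' ht'T hdist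
        have hθpos : 0 < θ := by linarith
        have hεθ : ε < θ := by linarith
        have h1 := hE1 hθpos hθt' ht'T
        have h2 := hE2 hηpos hmod hεpos hεθ hθt' ht'T (by linarith)
        have h3 : Kc * Real.sqrt (t' - θ) ≤ κ.toReal / 4 :=
          hsqrt (by positivity) (by linarith) (hdist.le.trans hρ3)
        have hA : ENNReal.ofReal (η * L) ≤ ENNReal.ofReal (κ.toReal / 4) :=
          ENNReal.ofReal_le_ofReal hηL
        have hB : 2 * ENNReal.ofReal (Kc * Real.sqrt ε) ≤ ENNReal.ofReal (κ.toReal / 4) := by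
          rw [show (2 : ℝ≥0∞) = ENNReal.ofReal 2 by norm_num, ← ENNReal.ofReal_mul (by norm_num)]
          exact ENNReal.ofReal_le_ofReal (by linarith)
        have hC' : ENNReal.ofReal (Kc * Real.sqrt (t' - θ)) ≤ ENNReal.ofReal (κ.toReal / 4) :=
          ENNReal.ofReal_le_ofReal h3
        calc eLpNorm (u t' - u θ) p volume
            ≤ eLpNorm (UnboundedOperators.heatExtension (u θ) (ν * (t' - θ)) - u θ) p volume +
                ENNReal.ofReal (Kc * Real.sqrt (t' - θ)) := h1
          _ ≤ (ENNReal.ofReal (η * L) + 2 * ENNReal.ofReal (Kc * Real.sqrt ε)) +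
                ENNReal.ofReal (Kc * Real.sqrt (t' - θ)) := add_le_add h2 le_rfl
          _ ≤ (ENNReal.ofReal (κ.toReal / 4) + ENNReal.ofReal (κ.toReal / 4)) +
                ENNReal.ofReal (κ.toReal / 4) := add_le_add (add_le_add hA hB) hC'
          _ = ENNReal.ofReal (κ.toReal / 4 + κ.toReal / 4 + κ.toReal / 4) := by
              rw [ENNReal.ofReal_add (by positivity) (by positivity),
                ENNReal.ofReal_add (by positivity) (by positivity)]
          _ ≤ ENNReal.ofReal κ.toReal := ENNReal.ofReal_le_ofReal (by linarith)
          _ = κ := hκeq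
      have hball : Metric.ball t₀ ρ ∈ 𝓝 t₀ := Metric.ball_mem_nhds t₀ hρpos
      filter_upwards [mem_nhdsWithin_of_mem_nhds hball, self_mem_nhdsWithin] with t htρ ht
      rw [Metric.mem_ball, Real.dist_eq] at htρ
      have habs := abs_lt.1 htρ
      have htpos : 0 < t := by linarith
      rw [hw_pos htpos, hw_pos ht₀pos]
      rcases lt_trichotomy t t₀ with hlt | heq | hgt
      · rw [eLpNorm_sub_comm]
        exact key (by linarith) hlt ht₀.2 (by linarith)
      · subst heq
        simp
      · exact key (by linarith) hgt ht.2 (by linarith)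

end FixedPoint

end Literature.Analysis.FluidPDE
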